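import Summits.NavierStokesRegularity.NavierStokesRegularity.Theorems.TypeICertificateLadderTargetTypeIZoomCompactness
import Summits.NavierStokesRegularity.NavierStokesRegularity.Theorems.TypeICertificateLadderTargetTypeIZoomPhysical
import Summits.NavierStokesRegularity.NavierStokesRegularity.Theorems.SqueezeCycleExtremalElementExistsRegularity
import Literature.Analysis.FluidPDE.TypeIAncientMildClassical
import Literature.Analysis.FluidPDE.KNSSTypeIRateMildProofs
import Literature.Analysis.FluidPDE.ClassicalSolutionRescale
import HarnessLib

/-!
# Crux `NoTypeIBlowup` (stmt-NavierStokesRegularity-1217), line `head-flux-channel`: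
  STUB S1a, the Type-I zoom to the Oseen-gauge rate class (`stub_typeIZoom`)

A classical solution of Navier–Stokes (viscosity `ν`) on `ℝ³ × [0, T)`, Leray–Hopf from its
rapidly decaying datum, with the eventual dimensionless rate `√(T − t)‖u(t, x)‖ ≤ C√ν`, which does
NOT extend classically past `T`, generates a Type-I ancient mild field `ū` with the SAME constant
`C` (`IsTypeIAncientMild C ū`) which is not identically zero.

Proof (Koch–Nadirashvili–Seregin–Šverák 2009, §6, the zoom of Theorem 6.2 run at Leray points
with a shifted vertex, keeping the Type-I window).
1. Normalise `ν = 1` (`typeIZoom_unit_viscosity`, helper 2): blow-up time `T₁ = νT`, same `C`.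
2. Rate window: `√(T₁ − t)‖u(t, x)‖ ≤ C` for `t ∈ (T', T₁)`, some `0 < T' < T₁`.
3. Leray points (`typeIZoom_leray_point`, helper 2): along `t_k = T₁ − (T₁ − T')/(k+2) ↑ T₁`
   there are `x_k` with `M_k = ‖u(t_k, x_k)‖ ≥ c/√(T₁ − t_k)`; with the rate,
   `S_k = (T₁ − t_k)M_k² ∈ [c², C²]`.
4. Zoom with the vertex shifted by `σ₀ = c²/2`: `λ_k = M_k⁻¹`, `t₀ = t_k + σ₀λ_k²`,
   `w_k(τ, y) = λ_k u(t₀ + λ_k²τ, x_k + λ_k y)` (`IsClassicalNSSolutionOn.nsRescale_translate_zero`)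
   is classical (`ν = 1`) on `(A_k, B_k)`, `A_k = (T' − t₀)M_k² ≤ −c²(k+2)/2 − σ₀ → −∞`,
   `B_k = S_k − σ₀ ≥ σ₀ > 0`; it satisfies the Oseen equation between all times of `(A_k, B_k)`
   (`typeIZoom_oseen_pairs`, helper 2, transported by `oseen_smul_stPull`) and the rate
   `√(−τ)‖w_k(τ, y)‖ ≤ C` on `(A_k, 0)` (as `−τλ_k² ≤ T₁ − t₀ − λ_k²τ`); and
   `‖w_k(−σ₀, 0)‖ = λ_k M_k = 1`.
5. Compactness (`typeIZoom_compactness`, helper 1) gives a subsequence and a limit `W` on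
   `(−∞, 0) × ℝ³`: continuous, weakly divergence free, Oseen-mild, `√(−τ)‖W‖ ≤ C`, with
   `w_{φ(k)}(τ) → W(τ)` locally uniformly; so `‖W(−σ₀, 0)‖ = 1` and `W ∈ IsTypeIAncientMild C`
   (`isTypeIAncientMild_of_continuous_oseenMild`, KNSS Prop. 4.1).

Lands `--supports stmt-NavierStokesRegularity-1217`.
-/

noncomputable section

namespace Summit.NavierStokesRegularity.NavierStokesRegularity.Theorems

open MeasureTheory Set Filter Topology
open scoped RealInnerProductSpace
open Literature.Analysis Literature.Analysis.FluidPDE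

/-! ### The zoom at unit viscosity -/

/-- **The Type-I zoom at unit viscosity** (KNSS 2009, §6, proof of Theorem 6.2, (6.2) and
Lemma 6.1, run at Leray points with the vertex shifted by `σ₀ = c²/2`; see the module
docstring, steps 2–5). For `C > 0`, `T > 0`, `(u, p)` classical (`ν = 1`) on `ℝ³ × [0, T)`,
Leray–Hopf from its rapidly decaying datum, with `√(T − t)‖u(t, x)‖ ≤ C` eventually as `t ↑ T`,
not extending classically past `T`: there is `W` with `IsTypeIAncientMild C W` and
`W(t, x) ≠ 0` for some `t < 0`.
[cite: KochNadirashviliSereginSverak2009, §6 proof of Thm 6.2 with Lemma 6.1 (arXiv:0709.3599 pp. 11–13)] -/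
theorem typeIZoom_unit {C T : ℝ} (hC : 0 < C) (hT : 0 < T)
    {u : ℝ → EuclideanSpace ℝ (Fin 3) → EuclideanSpace ℝ (Fin 3)}
    {p : ℝ → EuclideanSpace ℝ (Fin 3) → ℝ}
    (hcl : IsClassicalNSSolutionOn (Ico 0 T) 1 0 u p) (hLH : IsLerayHopfOn T 1 0 (u 0) u)
    (hdec : HasRapidSpatialDecay (u 0))
    (hrate : ∀ᶠ t in 𝓝[<] T, ∀ x, Real.sqrt (T - t) * ‖u t x‖ ≤ C)
    (hext : ¬ HasSmoothExtensionPast 1 0 u T) :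
    ∃ W : ℝ → EuclideanSpace ℝ (Fin 3) → EuclideanSpace ℝ (Fin 3),
      IsTypeIAncientMild C W ∧ ¬ (∀ t < 0, ∀ x, W t x = 0) := by
  -- ### Step 2: the rate window `(T', T)` with `0 < T'`
  obtain ⟨T₀, hT₀T, hT₀⟩ := mem_nhdsLT_iff_exists_Ioo_subset.1 hrate
  set T' : ℝ := max T₀ (T / 2) with hT'def
  have hT'T : T' < T := max_lt hT₀T (by linarith)
  have hT'pos : 0 < T' := lt_of_lt_of_le (by linarith) (le_max_right _ _)
  have hrate' : ∀ t ∈ Ioo T' T, ∀ x, Real.sqrt (T - t) * ‖u t x‖ ≤ C := fun t ht x =>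
    hT₀ ⟨lt_of_le_of_lt (le_max_left _ _) ht.1, ht.2⟩ x
  -- the Oseen equation between all pairs of positive times of `u`
  have hoseen : ∀ s t : ℝ, 0 < s → s < t → t < T → ∀ X,
      u t X = UnboundedOperators.heatExtension (u s) (t - s) X - oseenDuhamel 1 s u u t X := by
    intro s t hs hst htT X
    have h := typeIZoom_oseen_pairs 1 T u p one_pos hT hcl hLH hdec s t hs hst htT X
    rwa [one_mul] at h
  -- ### Step 3: Leray points along `t_k ↑ T`
  obtain ⟨c, hc, hler⟩ := typeIZoom_leray_point
  set δ : ℝ := T - T' with hδ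
  have hδpos : 0 < δ := sub_pos.2 hT'T
  set tk : ℕ → ℝ := fun k => T - δ / ((k : ℝ) + 2) with htk
  have hk2 : ∀ k : ℕ, (0 : ℝ) < (k : ℝ) + 2 := fun k => by positivity
  have hTtk : ∀ k, T - tk k = δ / ((k : ℝ) + 2) := fun k => by simp [htk]
  have htk_lt : ∀ k, tk k < T := fun k => by
    have : 0 < δ / ((k : ℝ) + 2) := div_pos hδpos (hk2 k)
    simp only [htk]; linarith
  have htk_gt : ∀ k, T' < tk k := fun k => by
    have : δ / ((k : ℝ) + 2) < δ := div_lt_self hδpos (by linarith [Nat.cast_nonneg (α := ℝ) k])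
    simp only [htk]; linarith
  have htk_ge : ∀ k, T' + δ / 2 ≤ tk k := fun k => by
    have : δ / ((k : ℝ) + 2) ≤ δ / 2 :=
      div_le_div_of_nonneg_left hδpos.le two_pos (by linarith [Nat.cast_nonneg (α := ℝ) k])
    simp only [htk]; linarith
  have htk0 : ∀ k, 0 ≤ tk k := fun k => (hT'pos.trans (htk_gt k)).le
  have hpt : ∀ k, ∃ x, c / Real.sqrt (T - tk k) ≤ ‖u (tk k) x‖ := by
    intro k
    obtain ⟨x, hx⟩ := hler one_pos hT hcl hLH hdec hext (tk k) ⟨htk0 k, htk_lt k⟩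
    refine ⟨x, ?_⟩
    simpa [Real.sqrt_one] using hx
  choose xk hxk using hpt
  set M : ℕ → ℝ := fun k => ‖u (tk k) (xk k)‖ with hMdef
  have hsqpos : ∀ k, 0 < Real.sqrt (T - tk k) := fun k => Real.sqrt_pos.2 (sub_pos.2 (htk_lt k))
  have hMlow : ∀ k, c / Real.sqrt (T - tk k) ≤ M k := hxk
  have hMpos : ∀ k, 0 < M k := fun k => lt_of_lt_of_le (div_pos hc (hsqpos k)) (hMlow k)
  have hcle : ∀ k, c ≤ Real.sqrt (T - tk k) * M k := fun k => by
    have h := (div_le_iff₀ (hsqpos k)).1 (hMlow k)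
    rwa [mul_comm] at h
  -- `S_k = (T − t_k) M_k² ≥ c²`
  have hS : ∀ k, c ^ 2 ≤ (T - tk k) * M k ^ 2 := fun k => by
    have h := pow_le_pow_left₀ hc.le (hcle k) 2
    rwa [mul_pow, Real.sq_sqrt (sub_pos.2 (htk_lt k)).le] at h
  -- `M_k² ≥ c² (k + 2) / δ`
  have hM2 : ∀ k : ℕ, c ^ 2 * ((k : ℝ) + 2) / δ ≤ M k ^ 2 := fun k => by
    have h := hS k
    rw [hTtk k] at h
    rw [div_le_iff₀ hδpos]
    have e : δ / ((k : ℝ) + 2) * M k ^ 2 * ((k : ℝ) + 2) = M k ^ 2 * δ := by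
      field_simp
    have h2 := mul_le_mul_of_nonneg_right h (hk2 k).le
    rw [e] at h2
    linarith
  -- ### Step 4: the zoom with the vertex shifted by `σ₀ = c²/2`
  set σ₀ : ℝ := c ^ 2 / 2 with hσ₀def
  have hσ₀ : 0 < σ₀ := by positivity
  set lam : ℕ → ℝ := fun k => (M k)⁻¹ with hlamdef
  have hlam : ∀ k, 0 < lam k := fun k => inv_pos.2 (hMpos k)
  have hlamM : ∀ k, lam k * M k = 1 := fun k => inv_mul_cancel₀ (hMpos k).ne'
  have hlam2 : ∀ k, lam k ^ 2 * M k ^ 2 = 1 := fun k => by rw [← mul_pow, hlamM, one_pow]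
  set t0 : ℕ → ℝ := fun k => tk k + σ₀ * lam k ^ 2 with ht0def
  set w : ℕ → ℝ → EuclideanSpace ℝ (Fin 3) → EuclideanSpace ℝ (Fin 3) :=
    fun k => lam k • stPull (lam k ^ 2) (lam k) (t0 k) (xk k) u with hwdef
  set q : ℕ → ℝ → EuclideanSpace ℝ (Fin 3) → ℝ :=
    fun k => lam k ^ 2 • stPull (lam k ^ 2) (lam k) (t0 k) (xk k) p with hqdef
  set A : ℕ → ℝ := fun k => (T' - t0 k) * M k ^ 2 with hAdef
  set B : ℕ → ℝ := fun k => (T - t0 k) * M k ^ 2 with hBdef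
  -- the physical time of `τ` is `t₀ + λ² τ`; `A_k ↦ T'`, `B_k ↦ T`
  have hphysA : ∀ k, t0 k + lam k ^ 2 * A k = T' := fun k => by
    have e : lam k ^ 2 * ((T' - t0 k) * M k ^ 2) = (T' - t0 k) * (lam k ^ 2 * M k ^ 2) := by ring
    simp only [hAdef]
    rw [e, hlam2, mul_one]
    ring
  have hphysB : ∀ k, t0 k + lam k ^ 2 * B k = T := fun k => by
    have e : lam k ^ 2 * ((T - t0 k) * M k ^ 2) = (T - t0 k) * (lam k ^ 2 * M k ^ 2) := by ring
    simp only [hBdef]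
    rw [e, hlam2, mul_one]
    ring
  have hphys_lt : ∀ k, ∀ {σ τ : ℝ}, σ < τ → t0 k + lam k ^ 2 * σ < t0 k + lam k ^ 2 * τ :=
    fun k σ τ h => by have := pow_pos (hlam k) 2; nlinarith
  have hphys : ∀ k, ∀ τ ∈ Ioo (A k) (B k), t0 k + lam k ^ 2 * τ ∈ Ioo T' T := fun k τ hτ =>
    ⟨by rw [← hphysA k]; exact hphys_lt k hτ.1, by rw [← hphysB k]; exact hphys_lt k hτ.2⟩
  -- `B_k = S_k − σ₀ ≥ σ₀ > 0`, `T − t₀ > 0`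
  have hBeq : ∀ k, B k = (T - tk k) * M k ^ 2 - σ₀ := fun k => by
    simp only [hBdef, ht0def]
    have := hlam2 k
    linear_combination (-σ₀) * this
  have hBpos : ∀ k, 0 < B k := fun k => by
    rw [hBeq k]
    have := hS k
    simp only [hσ₀def]
    nlinarith
  have hTt0 : ∀ k, 0 < T - t0 k := fun k => by
    have h1 : 0 < (T - t0 k) * M k ^ 2 := hBpos k
    exact lt_of_mul_lt_mul_right (by rwa [zero_mul]) (sq_nonneg (M k))
  -- `A_k → −∞`
  have hA_le : ∀ k : ℕ, A k ≤ -(c ^ 2 / 2) * ((k : ℝ) + 2) - σ₀ := fun k => by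
    have hAeq : A k = (T' - tk k) * M k ^ 2 - σ₀ := by
      simp only [hAdef, ht0def]
      have := hlam2 k
      linear_combination (-σ₀) * this
    rw [hAeq]
    have h1 : T' - tk k ≤ -(δ / 2) := by linarith [htk_ge k]
    have hM2k := hM2 k
    have hM20 : 0 ≤ M k ^ 2 := sq_nonneg _
    have h2 : (T' - tk k) * M k ^ 2 ≤ -(δ / 2) * M k ^ 2 := mul_le_mul_of_nonneg_right h1 hM20
    have h3 : -(δ / 2) * M k ^ 2 ≤ -(δ / 2) * (c ^ 2 * ((k : ℝ) + 2) / δ) :=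
      mul_le_mul_of_nonpos_left hM2k (by linarith)
    have h4 : -(δ / 2) * (c ^ 2 * ((k : ℝ) + 2) / δ) = -(c ^ 2 / 2) * ((k : ℝ) + 2) := by
      field_simp
    linarith
  have hAlim : Tendsto A atTop atBot := by
    have h1 : Tendsto (fun k : ℕ => (k : ℝ) + 2) atTop atTop :=
      tendsto_atTop_add_const_right _ _ tendsto_natCast_atTop_atTop
    have hneg : -(c ^ 2 / 2) < 0 := by linarith
    have h2 : Tendsto (fun k : ℕ => -(c ^ 2 / 2) * ((k : ℝ) + 2)) atTop atBot :=
      h1.const_mul_atTop_of_neg hneg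
    exact tendsto_atBot_mono hA_le (tendsto_atBot_add_const_right _ _ h2)
  -- the zoomed fields are classical on `(A_k, B_k)`
  have hwcl : ∀ k, IsClassicalNSSolutionOn (Ioo (A k) (B k)) 1 0 (w k) (q k) := by
    intro k
    have h := hcl.nsRescale_translate_zero (hlam k) (t0 k) (xk k)
    refine h.mono (fun τ hτ => ?_) isOpen_Ioo.uniqueDiffOn
    have hp := hphys k τ hτ
    exact ⟨(hT'pos.trans hp.1).le, hp.2⟩
  -- the Oseen equation between all times of `(A_k, B_k)`
  have hwmild : ∀ k, ∀ s t : ℝ, A k < s → s < t → t < B k → ∀ y,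
      w k t y = UnboundedOperators.heatExtension (w k s) (t - s) y -
        oseenDuhamel 1 s (w k) (w k) t y := by
    intro k s t hAs hst htB y
    refine oseen_smul_stPull (hlam k) (t0 k) (xk k) hst (fun X => ?_) y
    have hsB : s < B k := hst.trans htB
    have hs' : T' < t0 k + lam k ^ 2 * s := (hphys k s ⟨hAs, hsB⟩).1
    have ht' : t0 k + lam k ^ 2 * t < T := (hphys k t ⟨hAs.trans hst, htB⟩).2
    exact hoseen _ _ (hT'pos.trans hs') (hphys_lt k hst) ht' X
  -- the rate bound on `(A_k, 0)`
  have hwI : ∀ k, ∀ τ ∈ Ioo (A k) 0, ∀ y, Real.sqrt (-τ) * ‖w k τ y‖ ≤ C := by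
    intro k τ hτ y
    have e : w k τ y = lam k • u (t0 k + lam k ^ 2 * τ) (xk k + lam k • y) := rfl
    have ht : t0 k + lam k ^ 2 * τ ∈ Ioo T' T := hphys k τ ⟨hτ.1, hτ.2.trans (hBpos k)⟩
    have hr := hrate' _ ht (xk k + lam k • y)
    rw [e, norm_smul, Real.norm_eq_abs, abs_of_pos (hlam k)]
    have hkey : Real.sqrt (-τ) * lam k ≤ Real.sqrt (T - (t0 k + lam k ^ 2 * τ)) := by
      have e1 : Real.sqrt (-τ) * lam k = Real.sqrt (-τ * lam k ^ 2) := by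
        rw [Real.sqrt_mul (neg_nonneg.2 hτ.2.le), Real.sqrt_sq (hlam k).le]
      rw [e1]
      refine Real.sqrt_le_sqrt ?_
      have := hTt0 k
      nlinarith [pow_pos (hlam k) 2]
    calc Real.sqrt (-τ) * (lam k * ‖u (t0 k + lam k ^ 2 * τ) (xk k + lam k • y)‖)
        = (Real.sqrt (-τ) * lam k) * ‖u (t0 k + lam k ^ 2 * τ) (xk k + lam k • y)‖ := by ring
      _ ≤ Real.sqrt (T - (t0 k + lam k ^ 2 * τ)) * ‖u (t0 k + lam k ^ 2 * τ) (xk k + lam k • y)‖ :=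
          mul_le_mul_of_nonneg_right hkey (norm_nonneg _)
      _ ≤ C := hr
  -- `‖w_k(−σ₀, 0)‖ = 1`
  have hneg : -σ₀ < 0 := neg_neg_of_pos hσ₀
  have hnorm1 : ∀ k, ‖w k (-σ₀) 0‖ = 1 := fun k => by
    have e : w k (-σ₀) 0 =
        lam k • u (t0 k + lam k ^ 2 * (-σ₀)) (xk k + lam k • (0 : EuclideanSpace ℝ (Fin 3))) := rfl
    have et : t0 k + lam k ^ 2 * (-σ₀) = tk k := by simp only [ht0def]; ring
    rw [e, et, smul_zero, add_zero, norm_smul, Real.norm_eq_abs, abs_of_pos (hlam k)]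
    exact hlamM k
  -- ### Step 5: compactness and the limit
  obtain ⟨φ, W, -, hWc, hWdiv, hWI, hWmild, hWconv⟩ :=
    typeIZoom_compactness C A B w q hC hAlim hBpos hwcl hwmild hwI
  refine ⟨W, isTypeIAncientMild_of_continuous_oseenMild hWc hWdiv hWmild (fun t ht x => ?_),
    fun h0 => ?_⟩
  · rw [le_div_iff₀ (Real.sqrt_pos.2 (neg_pos.2 ht)), mul_comm]
    exact hWI t ht x
  · have hlim : Tendsto (fun k => w (φ k) (-σ₀) 0) atTop (𝓝 (W (-σ₀) 0)) :=
      (tendstoLocallyUniformlyOn_univ.2 (hWconv (-σ₀) hneg)).tendsto_at (mem_univ _)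
    have hlim1 : Tendsto (fun k => ‖w (φ k) (-σ₀) 0‖) atTop (𝓝 ‖W (-σ₀) 0‖) := hlim.norm
    have hone : Tendsto (fun k => ‖w (φ k) (-σ₀) 0‖) atTop (𝓝 1) := by
      simp only [hnorm1]
      exact tendsto_const_nhds
    have hW1 : ‖W (-σ₀) 0‖ = 1 := tendsto_nhds_unique hlim1 hone
    rw [h0 (-σ₀) hneg 0, norm_zero] at hW1
    exact zero_ne_one hW1

/-! ### The stub -/

/-- **S1a — Type-I ZOOM to the Oseen-gauge rate class, per rung constant.** A classical solution
of Navier–Stokes (viscosity `ν`) on `ℝ³ × [0,T)`, Leray–Hopf from its rapidly decaying datum, with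
the eventual dimensionless rate `√(T−t)‖u(t,x)‖ ≤ C√ν`, which does NOT extend classically past
`T`, generates a Type-I ancient mild field `ū` with the SAME constant `C` (`IsTypeIAncientMild C ū`:
jointly smooth on `t < 0`, divergence free, Oseen-mild between all pairs of negative times,
`‖ū(t,x)‖ ≤ C/√(−t)`), and `ū ≢ 0`. Proof: normalise `ν = 1` (`typeIZoom_unit_viscosity`, same
constant `C`) and zoom (`typeIZoom_unit`: KNSS 2009 §6 at Leray points with a shifted vertex,
compactness in the Type-I-rate Oseen-mild class, KNSS Prop. 4.1).
[cite: KochNadirashviliSereginSverak2009, §6 proof of Thm 6.2 with Lemma 6.1 (arXiv:0709.3599 pp. 11–13)] -/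
theorem stub_typeIZoom :
    ∀ C : ℝ, 0 < C → ∀ (ν T : ℝ), 0 < ν → 0 < T →
      ∀ (u : ℝ → EuclideanSpace ℝ (Fin 3) → EuclideanSpace ℝ (Fin 3))
        (p : ℝ → EuclideanSpace ℝ (Fin 3) → ℝ),
        IsClassicalNSSolutionOn (Set.Ico 0 T) ν 0 u p →
        IsLerayHopfOn T ν 0 (u 0) u →
        HasRapidSpatialDecay (u 0) →
        (∀ᶠ t in 𝓝[<] T, ∀ x, Real.sqrt (T - t) * ‖u t x‖ ≤ C * Real.sqrt ν) →
        ¬ HasSmoothExtensionPast ν 0 u T →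
        ∃ (ū : ℝ → EuclideanSpace ℝ (Fin 3) → EuclideanSpace ℝ (Fin 3)),
          IsTypeIAncientMild C ū ∧ ¬ (∀ t < 0, ∀ x, ū t x = 0) := by
  intro C hC ν T hν hT u p hcl hLH hdec hrate hext
  obtain ⟨v, π, hclv, hLHv, hdecv, hratev, hextv⟩ :=
    typeIZoom_unit_viscosity C ν T u p hν hT hcl hLH hdec hrate hext
  exact typeIZoom_unit hC (mul_pos hν hT) hclv hLHv hdecv hratev hextv

end Summit.NavierStokesRegularity.NavierStokesRegularity.Theorems

end
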